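import Literature.MathematicalPhysics.QuantumLattice.PeriodicClusterGibbsPressureFloor
import Literature.MathematicalPhysics.QuantumLattice.EmeryThreeBandPhysClusterTrialCap
import Literature.MathematicalPhysics.QuantumLattice.EmeryThreeBandWindowFloorsPlus
import Literature.MathematicalPhysics.QuantumLattice.EmeryThreeBandGeneralPairForm
import Literature.MathematicalPhysics.QuantumLattice.WeightedOpenClusterUniformWeightsPeriodic
import Literature.MathematicalPhysics.QuantumLattice.PeriodicVariationalPressureCouplings
import HarnessLib

/-!
# THE THREE-BAND (EMERY) `CuO₂` MODEL AT `T > 0`: the pressure `P(β,θ)`, its convexity / Lipschitz laws in `(β, θ)`, and the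
# TWO-SIDED CLUSTER WINDOW from ONE open `Cu_{k²}O_{2k²}` block — floor = its Gibbs free energy, cap = its boundary-boosted twin

Topic `Literature/MathematicalPhysics/QuantumLattice` (family `hubbard`). Written for stage S2 (CERTIFIER-FAMILIES) of the Hubbard material-oracle
programme, human ruling D-0096 (ii) «families of models … multi-band, T > 0» (crew hubbard-fast, seat hubbard-box-p1). The decorated-lattice
presentation `emeryInteraction θ` (`θ ∈ ℝ¹⁴`: Cu–O / O–O hoppings, site energies, repulsions; `2×2` cell = {Cu, O_x, O_y, dummy}) is
Hermitian, even, `2×2`-periodic and of range `1` (`emeryInteraction_structure`), so the whole periodic `T > 0` theory of the tree applies to it.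
This file names the object and opens the doors a certificate device needs:

* §1 **`emeryPressure β θ := P_{2×2}(β, emeryInteraction θ)`** (periodic variational pressure per site of the decorated `ℤ²`) and
  **`emeryCellPressure β θ := 4·emeryPressure β θ − 2 log 2`** (per `CuO₂` formula unit, the free dummy site's `log 4` removed); superlattice
  independence (`perVarPressure_eq_emeryPressure`), CONVEXITY in `β` and JOINTLY in `θ`, Lipschitz in `θ` and in `β`, a-priori window.
* §2 counting: the block `[0,2a)×[0,2b)` has `ab` dummy points and `3ab` physical sites (`card_emeryPhysSites`).
* §3 **THE FLOOR from the open `Cu_{ab}O_{2ab}` cluster** (`log_partitionFn_physCluster_le`): for every `θ`, real `β` and `a×b` cells,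
  `log Re Tr_S e^{−βH^θ_S} ≤ ab · emeryCellPressure β θ`, `S = emeryPhysSites m` the `3ab` physical sites — the exact product-Gibbs floor of
  `PeriodicClusterGibbsPressureFloor` (vanishing straddles: `rectTilingState_expect_emeryInteraction_eq_zero_of_straddle`; dummy reduction:
  `localHamiltonian_eq_fermionEmbed_of_support`).
* §4 **THE CAP from the boundary-boosted `Cu_{k²}O_{2k²}` cluster** (`emeryCellPressure_le_log_partitionFn_boost`, `k ≥ 2`): with the uniform
  `(2ℤ)²`-weight `w` of mass `k²` on `[0,2k)²` (inverse even-placement counts: interior bonds weight 1, boundary classes boosted) and any Hermitian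
  multiplier `G_S` on the physical sites killed by `2×2`-periodic states,
  `k² · emeryCellPressure β θ ≤ log Re Tr_S exp(−(β H^{w,θ}_S − G_S))` (`WeightedOpenClusterBoundsPeriodic.perVarPressure_le_log_partitionFn_reweight`
  + the same dummy reduction); hence **THE TWO-SIDED WINDOW FROM ONE CLUSTER GEOMETRY**
  `k⁻² log Re Z_S(β,θ) ≤ emeryCellPressure β θ ≤ k⁻² log Re Z^w_S(β,θ)` (`emeryCellPressure_mem_Icc_cluster`), both cluster operators in
  GENERAL-PAIR FORM for the kernel device (`EmeryThreeBandGeneralPairForm`): `H^{w,θ}_S = generalPairHamiltonian (emeryTau w θ S) (emeryUps …) (emeryNu …)`.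
* §5 **THERMAL OBSERVABLES**: periodic equilibrium states of the three-band model exist at every `(β, θ)`; their cell energy is bracketed by
  `β`-chords of `emeryPressure` and each of the fourteen conjugate densities (Cu–O / O–O bond energies, Cu / O_x / O_y occupations, Cu / O double
  occupancies per site) by `θ_a`-chords — from four certified numbers (`emery_cellObservable_mem_Icc_of_bounds`).

Everything is PROVED (0 sorry); definitions with bodies: `emeryPressure`, `emeryCellPressure`. HONEST SCOPE: laws and doors only — no cluster trace is
computed here; the smallest admissible CAP cluster is the 12-site `Cu₄O₈` (`k = 2`), the FLOOR takes any `a×b ≥ 1×1` (3, 6, 12, … sites); the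
window width is the open-cluster finite-size error, shrinking like `1/k`. A chemical potential is the level direction of `θ` (`Downfold.EmeryReferenceLevel`).

## Tree / Mathlib search

REUSED: `emeryInteraction(_structure/_apply_eq_zero_of_not_subset_phys)`, `emeryAtoms`, `liebPeriods(_add_one)`, `emeryPhysSites(_subset)`, `dummySite`,
`cellPos_dummy`, `alignedPeriods`, `dvd_alignedPeriods_add_one`, `latPt(_apply)`, `sum_halfOpenRect_aligned_eq_sum_sum`, `card_cell_alignedPeriods_liebPeriods`,
`card_cell_eq_card_halfOpenRect`, `rectTilingState_expect_emeryInteraction_eq_zero_of_straddle` (`EmeryThreeBand*`, `PeriodicRectTrialState`);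
`log_partitionFn_sub_le_card_mul_perVarPressure` (`PeriodicClusterGibbsPressureFloor`); `perVarPressure_le_log_partitionFn_reweight`
(`WeightedOpenClusterBoundsPeriodic`); `uniformPeriodicWeight(_admissible/_empty)` (`WeightedOpenClusterUniformWeightsPeriodic`); `emeryWindow_fit_of_cuO4_subset`,
`emeryCuO4Window` (`EmeryThreeBandWindowFloorsPlus/CuO4WindowFloor`); `localHamiltonian_reweight_emeryInteraction_eq_generalPair` (`EmeryThreeBandGeneralPairForm`);
`localHamiltonian_eq_fermionEmbed_of_support` (`FermionVacuumExtension`); `log_partitionFn_fermionEmbed`, `card_orb_polySite` (`FermionLocalHamiltonianCovariance`);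
`perVarPressure_eq_of_dvd`, `perVarPressure_mem_Icc`, `convexOn_perVarPressure_beta`, `convexOn_perVarPressure_linearFamily`, `abs_perVarPressure_linearFamily_sub_le`,
`abs_perVarPressure_sub_perVarPressure_beta_le`, `exists_isPerVarEquilibrium`, `IsPerVarEquilibrium.cellMeanEnergy_mem_Icc(_beta/_of_bounds)`
(`Periodic*`); `inCoset_cellPos_iff_eq_cellRes`, `IsPeriodic.expect`/`compatible`. `lean search 'emeryPressure|emery.*perVarPressure'` (2026-08-28): nothing.

## References

* V. J. Emery, Phys. Rev. Lett. 58 (1987) 2794 (the three-band model). [cite: Emery1987, eq. (1)]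
* E. Pavarini, I. Dasgupta, T. Saha-Dasgupta, O. Jepsen, O. K. Andersen, Phys. Rev. Lett. 87 (2001) 047003, eq. (1). [cite: PavariniEtAl2001, eq. (1)]
* R. B. Israel, *Convexity in the Theory of Lattice Gases* (1979), Lemma II.3.1, Thm. I.2.4, Thm. I.3.4. [cite: Israel1979, Lemma II.3.1]
* O. Bratteli, D. W. Robinson, *OAQSM 2* (1997), Thm. 6.2.40. [cite: BratteliRobinsonII1997, Thm. 6.2.40]
* R. Valentí, J. Stolze, P. J. Hirschfeld, Phys. Rev. B 43 (1991) 13743, §II (weighted clusters). [cite: ValentiStolzeHirschfeld1991, §II]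
* R. B. Griffiths, J. Math. Phys. 5 (1964) 1215, eq. (39) (tangent brackets). [cite: Griffiths1964, Eq. (39) and Fig. 3]
-/

noncomputable section

open scoped ComplexOrder BigOperators
open Finset

namespace Literature.MathematicalPhysics.QuantumLattice

open Matrix HubbardWave0 Literature.Probability.LatticeModels ThermodynamicLimit InfVolFermionState
open _root_.Filter
open scoped _root_.Topology

/-! ### §1. The three-band pressure -/

/-- **THE THREE-BAND (EMERY) PRESSURE** at inverse temperature `β` and coupling vector `θ ∈ ℝ¹⁴`: the `2×2`-periodic variational pressure
`P_{2×2}(β, emeryInteraction θ) = sup_{ω (2,2)-periodic}[s̄(ω) − β ē(ω)]` per site of the decorated lattice `ℤ²` (range parameter `1`).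
[cite: Israel1979, Thm. I.2.4] [cite: PavariniEtAl2001, eq. (1)] -/
def emeryPressure (β : ℝ) (θ : Fin 14 → ℝ) : ℝ := (emeryInteraction θ).perVarPressure β liebPeriods 1

/-- **THE THREE-BAND PRESSURE PER `CuO₂` FORMULA UNIT**, the free dummy site's `log 4` removed: `4·emeryPressure β θ − 2 log 2`.
[cite: Israel1979, Thm. I.2.4] [cite: PavariniEtAl2001, eq. (1)] -/
def emeryCellPressure (β : ℝ) (θ : Fin 14 → ℝ) : ℝ := 4 * emeryPressure β θ - 2 * Real.log 2

/-- Unfolding. [cite: Israel1979, Thm. I.2.4] -/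
theorem emeryPressure_def (β : ℝ) (θ : Fin 14 → ℝ) : emeryPressure β θ = (emeryInteraction θ).perVarPressure β liebPeriods 1 := rfl

/-- Unfolding. [cite: Israel1979, Thm. I.2.4] -/
theorem emeryCellPressure_def (β : ℝ) (θ : Fin 14 → ℝ) : emeryCellPressure β θ = 4 * emeryPressure β θ - 2 * Real.log 2 := rfl

/-- The pressure as the linear-family pressure (base: the empty one-band interaction; directions: the fourteen atoms). [cite: Israel1979, Thm. I.3.4] -/
theorem emeryPressure_eq_linearFamily (β : ℝ) (θ : Fin 14 → ℝ) :
    emeryPressure β θ = (FermionInteraction.linearFamily (hubbardFermionInteraction 2 0 0) emeryAtoms θ).perVarPressure β liebPeriods 1 := rfl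

/-- `liebPeriods i + 1 = 2`. [cite: PavariniEtAl2001, eq. (1)] -/
theorem liebPeriods_add_one_nat (i : Fin 2) : liebPeriods i + 1 = 2 := by
  fin_cases i <;> rfl

/-- The `2×2` cell has four points. [cite: ArakiMoriya2003, §4.1 Def. 4.3] -/
theorem card_cell_liebPeriods_eq : Fintype.card (Cell liebPeriods) = 4 := by
  rw [card_cell_two]; rfl

/-- **SUPERLATTICE INDEPENDENCE**: the pressure read on ANY coarser cell `q'` (`2 ∣ q'_i+1`) is `emeryPressure` (every real `β`).
[cite: Israel1979, Thm. I.2.4] -/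
theorem perVarPressure_eq_emeryPressure {q' : Fin 2 → ℕ} (hq' : ∀ i, 2 ∣ q' i + 1) (β : ℝ) (θ : Fin 14 → ℝ) :
    (emeryInteraction θ).perVarPressure β q' 1 = emeryPressure β θ := by
  obtain ⟨hH, hE, hP, hR⟩ := emeryInteraction_structure θ
  exact FermionInteraction.perVarPressure_eq_of_dvd (by norm_num) hH hE hP hR (fun i => by rw [liebPeriods_add_one_nat]; exact hq' i) β

/-- **A-priori window**: `−|β| S ≤ emeryPressure β θ ≤ 2 log 2 + |β| S`, `S` the cell site norm of `emeryInteraction θ`. [cite: BratteliRobinsonI1987, Prop. 2.3.11] -/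
theorem emeryPressure_mem_Icc (β : ℝ) (θ : Fin 14 → ℝ) :
    emeryPressure β θ ∈ Set.Icc (-(|β| * (emeryInteraction θ).cellSiteNorm liebPeriods 1))
      (2 * Real.log 2 + |β| * (emeryInteraction θ).cellSiteNorm liebPeriods 1) :=
  (emeryInteraction θ).perVarPressure_mem_Icc β liebPeriods 1

/-- **CONVEX IN `β`.** [cite: Israel1979, Thm. I.2.4] -/
theorem convexOn_emeryPressure_beta (θ : Fin 14 → ℝ) : ConvexOn ℝ Set.univ fun β : ℝ => emeryPressure β θ :=
  (emeryInteraction θ).convexOn_perVarPressure_beta liebPeriods 1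

/-- **JOINTLY CONVEX IN THE FOURTEEN COUPLINGS** (a supremum of affine functions of `θ`). [cite: Israel1979, Thm. I.3.4] -/
theorem convexOn_emeryPressure_couplings (β : ℝ) : ConvexOn ℝ Set.univ fun θ : Fin 14 → ℝ => emeryPressure β θ :=
  convexOn_perVarPressure_linearFamily (hubbardFermionInteraction 2 0 0) emeryAtoms β liebPeriods 1

/-- **JOINT LIPSCHITZ BOUND IN THE COUPLINGS**: `|P(β,θ) − P(β,θ')| ≤ |β| Σ_a |θ_a − θ'_a| S_a`, `S_a` the cell site norm of the atom `a`.
[cite: Israel1979, Thm. I.3.4] -/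
theorem abs_emeryPressure_sub_le (β : ℝ) (θ θ' : Fin 14 → ℝ) :
    |emeryPressure β θ - emeryPressure β θ'| ≤ |β| * ∑ a, |θ a - θ' a| * (emeryAtoms a).cellSiteNorm liebPeriods 1 :=
  abs_perVarPressure_linearFamily_sub_le (hubbardFermionInteraction 2 0 0) emeryAtoms β liebPeriods 1 θ θ'

/-- **LIPSCHITZ IN `β`**: `|P(β,θ) − P(β',θ)| ≤ |β − β'| S`. [cite: Israel1979, Thm. I.2.4] -/
theorem abs_emeryPressure_sub_emeryPressure_beta_le (β β' : ℝ) (θ : Fin 14 → ℝ) :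
    |emeryPressure β θ - emeryPressure β' θ| ≤ |β - β'| * (emeryInteraction θ).cellSiteNorm liebPeriods 1 :=
  (emeryInteraction θ).abs_perVarPressure_sub_perVarPressure_beta_le liebPeriods 1 β β'

/-- **Convexity between grid points**: `P(β, (1−s)θ + sθ') ≤ (1−s)P(β,θ) + sP(β,θ')` for `0 ≤ s ≤ 1` — certified caps at two coupling vectors cap
the segment. [cite: Israel1979, Thm. I.3.4] -/
theorem emeryPressure_segment_le (β : ℝ) (θ θ' : Fin 14 → ℝ) {s : ℝ} (hs0 : 0 ≤ s) (hs1 : s ≤ 1) :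
    emeryPressure β ((1 - s) • θ + s • θ') ≤ (1 - s) * emeryPressure β θ + s * emeryPressure β θ' :=
  perVarPressure_linearFamily_segment_le (hubbardFermionInteraction 2 0 0) emeryAtoms β liebPeriods 1 θ θ' hs0 hs1

/-! ### §2. Counting the physical sites of a block -/

/-- **Superlattice points do not change the coset**: `InCoset q c₀ (x + ℓ_q(pos k)) ↔ InCoset q c₀ x`. [cite: ArakiMoriya2003, §4.1 Def. 4.3] -/
theorem inCoset_add_latPt_iff {d : ℕ} (q m : Fin d → ℕ) (c₀ x : Site d) (k : Cell m) :
    InCoset q c₀ (x + latPt q m k) ↔ InCoset q c₀ x := by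
  refine forall_congr' fun i => ?_
  rw [Pi.add_apply, latPt_apply,
    show x i + ((k i : ℕ) : ℤ) * ((q i : ℤ) + 1) - c₀ i = x i - c₀ i + ((k i : ℕ) : ℤ) * ((q i : ℤ) + 1) by ring, Int.add_mul_emod_self_right]

/-- **The block `[0,2a)×[0,2b)` has exactly `ab` dummy points** (one per decorated cell). [cite: PavariniEtAl2001, eq. (1)] -/
theorem card_filter_inCoset_dummy_block (m : Fin 2 → ℕ) :
    #((halfOpenRect (alignedPeriods liebPeriods m)).filter fun y => InCoset liebPeriods dummySite y) = Fintype.card (Cell m) := by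
  classical
  rw [Finset.card_filter, sum_halfOpenRect_aligned_eq_sum_sum liebPeriods m (fun y => if InCoset liebPeriods dummySite y then 1 else 0)]
  simp_rw [inCoset_add_latPt_iff, inCoset_cellPos_iff_eq_cellRes]
  rw [Finset.sum_comm]
  simp only [Finset.sum_ite_eq', Finset.mem_univ, if_true, Finset.sum_const, Finset.card_univ, smul_eq_mul, mul_one]

/-- **THE BLOCK HAS `3ab` PHYSICAL SITES** (`Cu_{ab}O_{2ab}`). [cite: PavariniEtAl2001, eq. (1)] -/
theorem card_emeryPhysSites (m : Fin 2 → ℕ) : #(emeryPhysSites m) = 3 * Fintype.card (Cell m) := by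
  classical
  have h := Finset.card_filter_add_card_filter_not (s := halfOpenRect (alignedPeriods liebPeriods m))
    (fun y => InCoset liebPeriods dummySite y)
  rw [card_filter_inCoset_dummy_block, ← card_cell_eq_card_halfOpenRect, card_cell_alignedPeriods_liebPeriods] at h
  rw [emeryPhysSites]
  omega

/-- `|[0,2a)×[0,2b)| = 4ab` as a real number. [cite: ArakiMoriya2003, §4.1 Def. 4.3] -/
theorem card_halfOpenRect_block_eq (m : Fin 2 → ℕ) : (#(halfOpenRect (alignedPeriods liebPeriods m)) : ℝ) = 4 * Fintype.card (Cell m) := by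
  rw [← card_cell_eq_card_halfOpenRect, card_cell_alignedPeriods_liebPeriods]; push_cast; ring

/-- `|block| − |phys| = ab` dummy sites. [cite: PavariniEtAl2001, eq. (1)] -/
theorem card_block_sub_card_phys (m : Fin 2 → ℕ) :
    #(halfOpenRect (alignedPeriods liebPeriods m)) - #(emeryPhysSites m) = Fintype.card (Cell m) := by
  rw [← card_cell_eq_card_halfOpenRect, card_cell_alignedPeriods_liebPeriods, card_emeryPhysSites]
  omega

/-! ### §3. The floor from the open `Cu_{ab}O_{2ab}` cluster -/

/-- **The block Hamiltonian lives on the physical sites**: `H^θ_{[0,2a)×[0,2b)} = Γ(H^θ_S)`, `S = emeryPhysSites m`. [cite: PavariniEtAl2001, eq. (1)] -/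
theorem localHamiltonian_emeryInteraction_block_eq_fermionEmbed (θ : Fin 14 → ℝ) (m : Fin 2 → ℕ) :
    (emeryInteraction θ).localHamiltonian (halfOpenRect (alignedPeriods liebPeriods m)) =
      fermionEmbed (PolySite.incl (emeryPhysSites_subset m)) ((emeryInteraction θ).localHamiltonian (emeryPhysSites m)) :=
  (emeryInteraction θ).localHamiltonian_eq_fermionEmbed_of_support (emeryPhysSites_subset m)
    fun _ hX hXS => emeryInteraction_apply_eq_zero_of_not_subset_phys m θ hX hXS

/-- **THE FLOOR, block form**: `log Re Tr_S e^{−βH^θ_S} + 2ab·log 2 ≤ 4ab · emeryPressure β θ` for the `3ab`-site physical cluster `S` of the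
`a×b`-cell block, every `θ` and every real `β`. [cite: Israel1979, Lemma II.3.1] [cite: BratteliRobinsonII1997, Thm. 6.2.40] -/
theorem log_partitionFn_physCluster_add_le (β : ℝ) (θ : Fin 14 → ℝ) (m : Fin 2 → ℕ) :
    Real.log (Matrix.partitionFn β ((emeryInteraction θ).localHamiltonian (emeryPhysSites m))).re +
        2 * (Fintype.card (Cell m) : ℝ) * Real.log 2 ≤ 4 * (Fintype.card (Cell m) : ℝ) * emeryPressure β θ := by
  obtain ⟨hH, hE, hP, hR⟩ := emeryInteraction_structure θ
  have h := FermionInteraction.log_partitionFn_sub_le_card_mul_perVarPressure (alignedPeriods liebPeriods m) (by norm_num) hH hE hP hR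
    (dvd_alignedPeriods_add_one liebPeriods m)
    (fun σ hσe hσp hσt Y hY hY' => rectTilingState_expect_emeryInteraction_eq_zero_of_straddle _ σ hσe hσp hσt θ hY hY')
    (emeryPhysSites_subset m) (FermionInteraction.localHamiltonian_isHermitian hH _)
    (localHamiltonian_emeryInteraction_block_eq_fermionEmbed θ m) β
  rw [emeryInteraction_apply_empty, Matrix.zero_apply, Complex.zero_re, mul_zero, add_zero, card_block_sub_card_phys,
    card_halfOpenRect_block_eq, Nat.cast_mul, Nat.cast_ofNat] at h
  rw [emeryPressure]
  linarith [h]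

/-- **THE FLOOR, per formula unit**: `log Re Tr_S e^{−βH^θ_S} ≤ ab · emeryCellPressure β θ`. [cite: Israel1979, Lemma II.3.1] -/
theorem log_partitionFn_physCluster_le (β : ℝ) (θ : Fin 14 → ℝ) (m : Fin 2 → ℕ) :
    Real.log (Matrix.partitionFn β ((emeryInteraction θ).localHamiltonian (emeryPhysSites m))).re ≤
      (Fintype.card (Cell m) : ℝ) * emeryCellPressure β θ := by
  have h := log_partitionFn_physCluster_add_le β θ m
  rw [emeryCellPressure]
  nlinarith [h]

/-- **A certified number is a certified floor**: `ℓ ≤ log Re Tr_S e^{−βH^θ_S}` ⇒ `ℓ/ab ≤ emeryCellPressure β θ`. [cite: Israel1979, Lemma II.3.1] -/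
theorem div_le_emeryCellPressure_of_le_log_partitionFn (β : ℝ) (θ : Fin 14 → ℝ) (m : Fin 2 → ℕ) {ℓ : ℝ}
    (hℓ : ℓ ≤ Real.log (Matrix.partitionFn β ((emeryInteraction θ).localHamiltonian (emeryPhysSites m))).re) :
    ℓ / Fintype.card (Cell m) ≤ emeryCellPressure β θ := by
  have hc : (0 : ℝ) < Fintype.card (Cell m) := by exact_mod_cast Fintype.card_pos
  rw [div_le_iff₀' hc]
  exact hℓ.trans (log_partitionFn_physCluster_le β θ m)

/-- **The floor's cluster operator in GENERAL-PAIR FORM** (what the kernel device diagonalises): `H^θ_S = generalPairHamiltonian (emeryTau 1 θ S) …`.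
[cite: ValentiStolzeHirschfeld1991, §II] [cite: PavariniEtAl2001, eq. (1)] -/
theorem localHamiltonian_emeryInteraction_eq_generalPair (θ : Fin 14 → ℝ) (S : Finset (Site 2)) :
    (emeryInteraction θ).localHamiltonian S =
      generalPairHamiltonian (emeryTau (fun _ => 1) θ S) (emeryUps (fun _ => 1) θ S) (emeryNu (fun _ => 1) θ S) := by
  rw [← localHamiltonian_reweight_emeryInteraction_eq_generalPair (fun _ => (1 : ℝ)) θ S]
  congr 1
  cases h : emeryInteraction θ with
  | mk Φ => simp

/-! ### §4. The cap from the boundary-boosted `Cu_{k²}O_{2k²}` cluster, and the two-sided window -/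

/-- `[0,2k)² = the (k−1,k−1)-block of the decorated lattice` (`k ≥ 1`). [cite: ArakiMoriya2003, §4.1 Def. 4.3] -/
theorem halfOpenBox_eq_halfOpenRect_block {k : ℕ} (hk : 1 ≤ k) :
    halfOpenBox 2 (2 * k) = halfOpenRect (alignedPeriods liebPeriods fun _ => k - 1) := by
  ext x
  rw [mem_halfOpenBox, mem_halfOpenRect]
  refine forall_congr' fun i => ?_
  rw [alignedPeriods_add_one_int, liebPeriods_add_one]
  have hk' : (((k - 1 : ℕ) : ℤ) + 1) = k := by omega
  rw [hk']
  push_cast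
  exact Iff.rfl

/-- The plus window lies in `[0,2k)²` for `k ≥ 2`. [cite: ValentiStolzeHirschfeld1991, §II] -/
theorem emeryCuO4Window_subset_halfOpenBox {k : ℕ} (hk : 2 ≤ k) : emeryCuO4Window ⊆ halfOpenBox 2 (2 * k) := by
  intro x hx
  have hx4 : x ∈ halfOpenBox 2 4 := Finset.mem_of_mem_filter x hx
  rw [mem_halfOpenBox] at hx4 ⊢
  intro i
  obtain ⟨h0, h4⟩ := hx4 i
  refine ⟨h0, lt_of_lt_of_le h4 ?_⟩
  push_cast
  omega

/-- The physical sites of the `(k−1,k−1)`-block lie in `[0,2k)²` (`k ≥ 1`). [cite: PavariniEtAl2001, eq. (1)] -/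
theorem emeryPhysSites_subset_halfOpenBox {k : ℕ} (hk : 1 ≤ k) : emeryPhysSites (fun _ : Fin 2 => k - 1) ⊆ halfOpenBox 2 (2 * k) := by
  rw [halfOpenBox_eq_halfOpenRect_block hk]
  exact emeryPhysSites_subset _

/-- `|[0,2k)²| − |Cu_{k²}O_{2k²}| = k²` dummy sites (`k ≥ 1`). [cite: PavariniEtAl2001, eq. (1)] -/
theorem card_halfOpenBox_sub_card_phys {k : ℕ} (hk : 1 ≤ k) :
    #(halfOpenBox 2 (2 * k)) - #(emeryPhysSites fun _ : Fin 2 => k - 1) = k ^ 2 := by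
  rw [halfOpenBox_eq_halfOpenRect_block hk, card_block_sub_card_phys, card_cell_two, Nat.sub_add_cancel hk, sq]

/-- `|Cell (k−1,k−1)| = k²` (`k ≥ 1`). [cite: ArakiMoriya2003, §4.1 Def. 4.3] -/
theorem card_cell_sq {k : ℕ} (hk : 1 ≤ k) : Fintype.card (Cell fun _ : Fin 2 => k - 1) = k ^ 2 := by
  rw [card_cell_two, Nat.sub_add_cancel hk, sq]

/-- **The boosted cube Hamiltonian lives on the physical sites**: for every weight `w`,
`H^{w,θ}_{[0,2k)²} = Γ(H^{w,θ}_S)`, `S = emeryPhysSites (k−1,k−1)` (`k ≥ 1`). [cite: PavariniEtAl2001, eq. (1)] -/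
theorem localHamiltonian_reweight_emeryInteraction_cube_eq_fermionEmbed {k : ℕ} (hk : 1 ≤ k) (w : Finset (Site 2) → ℝ) (θ : Fin 14 → ℝ) :
    (⟨fun X => (w X : ℂ) • (emeryInteraction θ).Φ X⟩ : FermionInteraction 2).localHamiltonian (halfOpenBox 2 (2 * k)) =
      fermionEmbed (PolySite.incl (emeryPhysSites_subset_halfOpenBox hk))
        ((⟨fun X => (w X : ℂ) • (emeryInteraction θ).Φ X⟩ : FermionInteraction 2).localHamiltonian (emeryPhysSites fun _ : Fin 2 => k - 1)) := by
  refine FermionInteraction.localHamiltonian_eq_fermionEmbed_of_support _ (emeryPhysSites_subset_halfOpenBox hk) fun X hX hXS => ?_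
  rw [halfOpenBox_eq_halfOpenRect_block hk] at hX
  change (w X : ℂ) • (emeryInteraction θ).Φ X = 0
  rw [emeryInteraction_apply_eq_zero_of_not_subset_phys _ θ hX hXS, smul_zero]

/-- **THE CAP, block form.** For `k ≥ 2`, every `θ`, every real `β`, the uniform `(2ℤ)²`-weight `w` of mass `k²` on `[0,2k)²` and any Hermitian
multiplier `G_S` on the physical sites `S` killed by every `2×2`-periodic state:
`4k² · emeryPressure β θ ≤ log Re Tr_S exp(−(β H^{w,θ}_S − G_S)) + 2k²·log 2`. [cite: Israel1979, Lemma II.3.1] [cite: ValentiStolzeHirschfeld1991, §II] -/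
theorem emeryPressure_le_log_partitionFn_boost {k : ℕ} (hk : 2 ≤ k) (β : ℝ) (θ : Fin 14 → ℝ)
    {G : FermionOp (emeryPhysSites fun _ : Fin 2 => k - 1)} (hGh : G.IsHermitian)
    (hG0 : ∀ ω' : InfVolFermionState 2, ω'.IsPeriodic liebPeriods → (ω'.expect (emeryPhysSites fun _ : Fin 2 => k - 1) G).re = 0) :
    4 * (k : ℝ) ^ 2 * emeryPressure β θ ≤
      Real.log (Matrix.partitionFn 1 ((β : ℂ) •
          (⟨fun X => (uniformPeriodicWeight liebPeriods (halfOpenBox 2 (2 * k)) ((k : ℝ) ^ 2) X : ℂ) • (emeryInteraction θ).Φ X⟩ :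
            FermionInteraction 2).localHamiltonian (emeryPhysSites fun _ : Fin 2 => k - 1) - G)).re +
        2 * (k : ℝ) ^ 2 * Real.log 2 := by
  obtain ⟨hH, -, hP, hR⟩ := emeryInteraction_structure θ
  have hk1 : 1 ≤ k := le_trans (by norm_num) hk
  have hSB := emeryPhysSites_subset_halfOpenBox hk1
  -- the cap on the aligned cube `[0,2k)²` with the embedded multiplier
  have hfit := emeryWindow_fit_of_cuO4_subset θ (emeryCuO4Window_subset_halfOpenBox hk)
  have hM : ((k : ℝ) ^ 2) * (Fintype.card (Cell liebPeriods) : ℝ) = ((2 * k : ℕ) : ℝ) ^ 2 := by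
    rw [card_cell_liebPeriods_eq]; push_cast; ring
  have hGB : (fermionEmbed (PolySite.incl hSB) G).IsHermitian := by
    rw [Matrix.IsHermitian, ← fermionEmbed_conjTranspose, hGh.eq]
  have hGB0 : ∀ ω' : InfVolFermionState 2, ω'.IsPeriodic liebPeriods →
      (ω'.expect (halfOpenBox 2 (2 * k)) (fermionEmbed (PolySite.incl hSB) G)).re = 0 :=
    fun ω' hω' => by rw [ω'.compatible hSB]; exact hG0 ω' hω'
  have hcap := perVarPressure_le_log_partitionFn_reweight (by norm_num) hH hP hR β (show 1 ≤ 2 * k by omega)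
    (fun i => by rw [liebPeriods_add_one_nat]; exact dvd_mul_right 2 k) (uniformPeriodicWeight liebPeriods (halfOpenBox 2 (2 * k)) ((k : ℝ) ^ 2))
    hM (uniformPeriodicWeight_admissible (halfOpenBox 2 (2 * k)) _ hfit) hGB hGB0
  -- reduce the cube operator to the physical sites
  have hHw := FermionInteraction.localHamiltonian_isHermitian (hH.reweight (uniformPeriodicWeight liebPeriods (halfOpenBox 2 (2 * k)) ((k : ℝ) ^ 2)))
    (emeryPhysSites fun _ : Fin 2 => k - 1)
  have hKh : ((β : ℂ) • (⟨fun X => (uniformPeriodicWeight liebPeriods (halfOpenBox 2 (2 * k)) ((k : ℝ) ^ 2) X : ℂ) • (emeryInteraction θ).Φ X⟩ :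
      FermionInteraction 2).localHamiltonian (emeryPhysSites fun _ : Fin 2 => k - 1) - G).IsHermitian := by
    have h1 : ((β : ℂ) • (⟨fun X => (uniformPeriodicWeight liebPeriods (halfOpenBox 2 (2 * k)) ((k : ℝ) ^ 2) X : ℂ) • (emeryInteraction θ).Φ X⟩ :
        FermionInteraction 2).localHamiltonian (emeryPhysSites fun _ : Fin 2 => k - 1)).IsHermitian := by
      rw [Matrix.IsHermitian, Matrix.conjTranspose_smul, hHw.eq, Complex.star_def, Complex.conj_ofReal]
    exact h1.sub hGh
  rw [localHamiltonian_reweight_emeryInteraction_cube_eq_fermionEmbed hk1, ← map_smul, ← map_sub,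
    log_partitionFn_fermionEmbed (PolySite.incl hSB) 1 hKh, card_orb_polySite, card_orb_polySite, ← Nat.sub_mul, card_halfOpenBox_sub_card_phys hk1,
    uniformPeriodicWeight_empty, zero_mul, mul_zero, add_zero] at hcap
  have e2 : ((2 * k : ℕ) : ℝ) ^ 2 = 4 * (k : ℝ) ^ 2 := by push_cast; ring
  have e3 : ((k ^ 2 * 2 : ℕ) : ℝ) * Real.log 2 = 2 * (k : ℝ) ^ 2 * Real.log 2 := by push_cast; ring
  rw [e2, e3] at hcap
  rw [emeryPressure_def]
  exact hcap

/-- **THE CAP, per formula unit**: `k² · emeryCellPressure β θ ≤ log Re Tr_S exp(−(β H^{w,θ}_S − G_S))` (`k ≥ 2`).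
[cite: Israel1979, Lemma II.3.1] [cite: ValentiStolzeHirschfeld1991, §II] -/
theorem emeryCellPressure_le_log_partitionFn_boost {k : ℕ} (hk : 2 ≤ k) (β : ℝ) (θ : Fin 14 → ℝ)
    {G : FermionOp (emeryPhysSites fun _ : Fin 2 => k - 1)} (hGh : G.IsHermitian)
    (hG0 : ∀ ω' : InfVolFermionState 2, ω'.IsPeriodic liebPeriods → (ω'.expect (emeryPhysSites fun _ : Fin 2 => k - 1) G).re = 0) :
    (k : ℝ) ^ 2 * emeryCellPressure β θ ≤
      Real.log (Matrix.partitionFn 1 ((β : ℂ) •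
          (⟨fun X => (uniformPeriodicWeight liebPeriods (halfOpenBox 2 (2 * k)) ((k : ℝ) ^ 2) X : ℂ) • (emeryInteraction θ).Φ X⟩ :
            FermionInteraction 2).localHamiltonian (emeryPhysSites fun _ : Fin 2 => k - 1) - G)).re := by
  have h := emeryPressure_le_log_partitionFn_boost hk β θ hGh hG0
  rw [emeryCellPressure]
  linarith [h]

/-- **THE CAP without multiplier** (`G = 0`): `k² · emeryCellPressure β θ ≤ log Re Tr_S e^{−βH^{w,θ}_S}` (`k ≥ 2`). [cite: Israel1979, Lemma II.3.1] -/
theorem emeryCellPressure_le_log_partitionFn_boost_zero {k : ℕ} (hk : 2 ≤ k) (β : ℝ) (θ : Fin 14 → ℝ) :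
    (k : ℝ) ^ 2 * emeryCellPressure β θ ≤
      Real.log (Matrix.partitionFn β
          ((⟨fun X => (uniformPeriodicWeight liebPeriods (halfOpenBox 2 (2 * k)) ((k : ℝ) ^ 2) X : ℂ) • (emeryInteraction θ).Φ X⟩ :
            FermionInteraction 2).localHamiltonian (emeryPhysSites fun _ : Fin 2 => k - 1))).re := by
  have h := emeryCellPressure_le_log_partitionFn_boost hk β θ (Matrix.isHermitian_zero : (0 : FermionOp (emeryPhysSites fun _ : Fin 2 => k - 1)).IsHermitian)
    (fun ω' _ => by rw [map_zero, Complex.zero_re])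
  rw [sub_zero, partitionFn_one_real_smul] at h
  exact h

/-- **The cap's cluster operator in GENERAL-PAIR FORM** (what the kernel device bounds): with `w` the uniform `(2ℤ)²`-weight of mass `k²` on `[0,2k)²`,
`k² · emeryCellPressure β θ ≤ log Re Tr_S exp(−(β · generalPairHamiltonian (emeryTau w θ S) (emeryUps w θ S) (emeryNu w θ S) − G_S))`.
[cite: ValentiStolzeHirschfeld1991, §II] [cite: PavariniEtAl2001, eq. (1)] -/
theorem emeryCellPressure_le_log_partitionFn_generalPair {k : ℕ} (hk : 2 ≤ k) (β : ℝ) (θ : Fin 14 → ℝ)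
    {G : FermionOp (emeryPhysSites fun _ : Fin 2 => k - 1)} (hGh : G.IsHermitian)
    (hG0 : ∀ ω' : InfVolFermionState 2, ω'.IsPeriodic liebPeriods → (ω'.expect (emeryPhysSites fun _ : Fin 2 => k - 1) G).re = 0) :
    (k : ℝ) ^ 2 * emeryCellPressure β θ ≤
      Real.log (Matrix.partitionFn 1 ((β : ℂ) •
          generalPairHamiltonian
            (emeryTau (uniformPeriodicWeight liebPeriods (halfOpenBox 2 (2 * k)) ((k : ℝ) ^ 2)) θ (emeryPhysSites fun _ : Fin 2 => k - 1))
            (emeryUps (uniformPeriodicWeight liebPeriods (halfOpenBox 2 (2 * k)) ((k : ℝ) ^ 2)) θ (emeryPhysSites fun _ : Fin 2 => k - 1))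
            (emeryNu (uniformPeriodicWeight liebPeriods (halfOpenBox 2 (2 * k)) ((k : ℝ) ^ 2)) θ (emeryPhysSites fun _ : Fin 2 => k - 1)) -
          G)).re := by
  rw [← localHamiltonian_reweight_emeryInteraction_eq_generalPair]
  exact emeryCellPressure_le_log_partitionFn_boost hk β θ hGh hG0

/-- **THE TWO-SIDED WINDOW FROM ONE CLUSTER GEOMETRY** (`k ≥ 2`; `S = Cu_{k²}O_{2k²}`, the `3k²` physical sites of `[0,2k)²`):
`k⁻² · log Re Tr_S e^{−βH^θ_S} ≤ emeryCellPressure β θ ≤ k⁻² · log Re Tr_S e^{−βH^{w,θ}_S}` — the open cluster below, its boundary-boosted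
twin above. [cite: Israel1979, Lemma II.3.1] [cite: BratteliRobinsonII1997, Thm. 6.2.40] [cite: ValentiStolzeHirschfeld1991, §II] -/
theorem emeryCellPressure_mem_Icc_cluster {k : ℕ} (hk : 2 ≤ k) (β : ℝ) (θ : Fin 14 → ℝ) :
    emeryCellPressure β θ ∈ Set.Icc
      (Real.log (Matrix.partitionFn β ((emeryInteraction θ).localHamiltonian (emeryPhysSites fun _ : Fin 2 => k - 1))).re / (k : ℝ) ^ 2)
      (Real.log (Matrix.partitionFn β
          ((⟨fun X => (uniformPeriodicWeight liebPeriods (halfOpenBox 2 (2 * k)) ((k : ℝ) ^ 2) X : ℂ) • (emeryInteraction θ).Φ X⟩ :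
            FermionInteraction 2).localHamiltonian (emeryPhysSites fun _ : Fin 2 => k - 1))).re / (k : ℝ) ^ 2) := by
  have hk1 : 1 ≤ k := le_trans (by norm_num) hk
  have hk0 : (0 : ℝ) < (k : ℝ) ^ 2 := by positivity
  have hlo := log_partitionFn_physCluster_le β θ (fun _ : Fin 2 => k - 1)
  rw [card_cell_sq hk1, Nat.cast_pow] at hlo
  have hhi := emeryCellPressure_le_log_partitionFn_boost_zero hk β θ
  constructor
  · rw [div_le_iff₀ hk0]; linarith
  · rw [le_div_iff₀ hk0]; linarith

/-- **FROM CERTIFIED NUMBERS**: a lower bound `ℓ ≤ log Re Tr_{S'} e^{−βH^θ_{S'}}` on the open `Cu_{ab}O_{2ab}` cluster and an upper bound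
`log Re Tr_S exp(−(βH^{w,θ}_S − G_S)) ≤ u` on the boosted `Cu_{k²}O_{2k²}` cluster give `ℓ/(ab) ≤ emeryCellPressure β θ ≤ u/k²`.
[cite: Israel1979, Lemma II.3.1] -/
theorem emeryCellPressure_mem_Icc_of_certificates (β : ℝ) (θ : Fin 14 → ℝ) (m : Fin 2 → ℕ) {k : ℕ} (hk : 2 ≤ k) {ℓ u : ℝ}
    (hℓ : ℓ ≤ Real.log (Matrix.partitionFn β ((emeryInteraction θ).localHamiltonian (emeryPhysSites m))).re)
    {G : FermionOp (emeryPhysSites fun _ : Fin 2 => k - 1)} (hGh : G.IsHermitian)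
    (hG0 : ∀ ω' : InfVolFermionState 2, ω'.IsPeriodic liebPeriods → (ω'.expect (emeryPhysSites fun _ : Fin 2 => k - 1) G).re = 0)
    (hu : Real.log (Matrix.partitionFn 1 ((β : ℂ) •
          (⟨fun X => (uniformPeriodicWeight liebPeriods (halfOpenBox 2 (2 * k)) ((k : ℝ) ^ 2) X : ℂ) • (emeryInteraction θ).Φ X⟩ :
            FermionInteraction 2).localHamiltonian (emeryPhysSites fun _ : Fin 2 => k - 1) - G)).re ≤ u) :
    emeryCellPressure β θ ∈ Set.Icc (ℓ / Fintype.card (Cell m)) (u / (k : ℝ) ^ 2) := by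
  have hk2 : (2 : ℝ) ≤ k := by exact_mod_cast hk
  have hk0 : (0 : ℝ) < (k : ℝ) ^ 2 := by positivity
  refine ⟨div_le_emeryCellPressure_of_le_log_partitionFn β θ m hℓ, ?_⟩
  rw [le_div_iff₀ hk0]
  linarith [emeryCellPressure_le_log_partitionFn_boost hk β θ hGh hG0]

/-! ### §5. Thermal observables of the three-band model: equilibrium states and their Griffiths brackets -/

/-- **PERIODIC EQUILIBRIUM STATES OF THE THREE-BAND MODEL EXIST** at every `(β, θ)` (`2×2`-periodic maximisers of `s̄ − β ē`).
[cite: BratteliRobinsonII1997, Thm. 6.2.40] [cite: Israel1979, Thm. I.2.4] -/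
theorem exists_isPerVarEquilibrium_emery (β : ℝ) (θ : Fin 14 → ℝ) :
    ∃ ω : InfVolFermionState 2, ω.IsPerVarEquilibrium β liebPeriods (emeryInteraction θ) 1 :=
  (emeryInteraction θ).exists_isPerVarEquilibrium (by norm_num) β liebPeriods 1

/-- **THERMAL ENERGY WINDOW**: for an equilibrium `ω` at `(β, θ)` and `δ > 0`,
`(P(β,θ) − P(β+δ,θ))/δ ≤ ē(ω) ≤ (P(β−δ,θ) − P(β,θ))/δ` (`ē` = energy per site of the decorated lattice = cell energy/4).
[cite: Israel1979, Thm. I.2.4] [cite: Griffiths1964, Eq. (39) and Fig. 3] -/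
theorem emery_cellMeanEnergy_mem_Icc_beta {β : ℝ} {θ : Fin 14 → ℝ} {ω : InfVolFermionState 2}
    (h : ω.IsPerVarEquilibrium β liebPeriods (emeryInteraction θ) 1) {δ : ℝ} (hδ : 0 < δ) :
    cellMeanEnergy liebPeriods (emeryInteraction θ) ω 1 ∈
      Set.Icc ((emeryPressure β θ - emeryPressure (β + δ) θ) / δ) ((emeryPressure (β - δ) θ - emeryPressure β θ) / δ) :=
  h.cellMeanEnergy_mem_Icc_beta hδ

/-- **THERMAL ENERGY WINDOW FROM THREE CERTIFIED NUMBERS**: a floor `L ≤ P(β,θ)` (e.g. `log_partitionFn_physCluster_le`) and caps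
`P(β+δ,θ) ≤ U₊`, `P(β−δ,θ) ≤ U₋` (e.g. `emeryPressure_le_log_partitionFn_boost`) give `(L − U₊)/δ ≤ ē(ω) ≤ (U₋ − L)/δ` for EVERY equilibrium at `(β,θ)`.
[cite: Griffiths1964, Eq. (39) and Fig. 3] [cite: Israel1979, Thm. I.2.4] -/
theorem emery_cellMeanEnergy_mem_Icc_of_bounds {β : ℝ} {θ : Fin 14 → ℝ} {ω : InfVolFermionState 2}
    (h : ω.IsPerVarEquilibrium β liebPeriods (emeryInteraction θ) 1) {δ : ℝ} (hδ : 0 < δ) {L Uplus Uminus : ℝ}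
    (hL : L ≤ emeryPressure β θ) (hUp : emeryPressure (β + δ) θ ≤ Uplus) (hUm : emeryPressure (β - δ) θ ≤ Uminus) :
    cellMeanEnergy liebPeriods (emeryInteraction θ) ω 1 ∈ Set.Icc ((L - Uplus) / δ) ((Uminus - L) / δ) := by
  have hw := emery_cellMeanEnergy_mem_Icc_beta h hδ
  constructor
  · exact le_trans (div_le_div_of_nonneg_right (by linarith) hδ.le) hw.1
  · exact le_trans hw.2 (div_le_div_of_nonneg_right (by linarith) hδ.le)

/-- **CONJUGATE-DENSITY BRACKETS** (`β, δ > 0`): for an equilibrium `ω` at `(β,θ)` and each direction `a` (Cu–O / O–O bond energies `a < 8`,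
Cu / O_x / O_y occupations `a = 8,9,10`, Cu / O_x / O_y double occupancies `a = 11,12,13`, all per site of the decorated lattice = per cell/4):
`(P(θ) − P(θ+δ1_a))/(βδ) ≤ ē_a(ω) ≤ (P(θ−δ1_a) − P(θ))/(βδ)`. [cite: Griffiths1964, Eq. (39) and Fig. 3] [cite: Israel1979, Thm. I.2.4] -/
theorem emery_cellObservable_mem_Icc {β : ℝ} (hβ : 0 < β) {θ : Fin 14 → ℝ} {ω : InfVolFermionState 2}
    (h : ω.IsPerVarEquilibrium β liebPeriods (emeryInteraction θ) 1) (a : Fin 14) {δ : ℝ} (hδ : 0 < δ) :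
    cellMeanEnergy liebPeriods (emeryAtoms a) ω 1 ∈
      Set.Icc ((emeryPressure β θ - emeryPressure β (θ + Pi.single a δ)) / (β * δ))
        ((emeryPressure β (θ + Pi.single a (-δ)) - emeryPressure β θ) / (β * δ)) :=
  InfVolFermionState.IsPerVarEquilibrium.cellMeanEnergy_mem_Icc (Ψ₀ := hubbardFermionInteraction 2 0 0) (Ψv := emeryAtoms) hβ h a hδ

/-- **CONJUGATE DENSITIES FROM FOUR CERTIFIED NUMBERS**: a floor `L ≤ P(β,θ)` and caps `P(β, θ ± δ1_a) ≤ U_±` give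
`(L − U₊)/(βδ) ≤ ē_a(ω) ≤ (U₋ − L)/(βδ)` for every equilibrium at `(β,θ)` — e.g. the Cu and O hole contents of the `CuO₂` plane at temperature `1/β`
from one open and three boosted cluster traces. [cite: Griffiths1964, Eq. (39) and Fig. 3] [cite: Israel1979, Thm. I.2.4] -/
theorem emery_cellObservable_mem_Icc_of_bounds {β : ℝ} (hβ : 0 < β) {θ : Fin 14 → ℝ} {ω : InfVolFermionState 2}
    (h : ω.IsPerVarEquilibrium β liebPeriods (emeryInteraction θ) 1) (a : Fin 14) {δ : ℝ} (hδ : 0 < δ) {L Uplus Uminus : ℝ}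
    (hL : L ≤ emeryPressure β θ) (hUp : emeryPressure β (θ + Pi.single a δ) ≤ Uplus)
    (hUm : emeryPressure β (θ + Pi.single a (-δ)) ≤ Uminus) :
    cellMeanEnergy liebPeriods (emeryAtoms a) ω 1 ∈ Set.Icc ((L - Uplus) / (β * δ)) ((Uminus - L) / (β * δ)) := by
  have hw := emery_cellObservable_mem_Icc hβ h a hδ
  have hβδ : 0 < β * δ := mul_pos hβ hδ
  constructor
  · exact le_trans (div_le_div_of_nonneg_right (by linarith) hβδ.le) hw.1
  · exact le_trans hw.2 (div_le_div_of_nonneg_right (by linarith) hβδ.le)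

end Literature.MathematicalPhysics.QuantumLattice

end
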